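import Literature.Combinatorics.LorentzianPolynomials.IndependencePolynomial
import Literature.Combinatorics.LorentzianPolynomials.ParallelOver
import Literature.Combinatorics.LorentzianPolynomials.LoopMultipartiteSignature
import HarnessLib

/-!
# The homogenised independence polynomial `f_M = Σ_{I ∈ 𝓘(M)} w^I w_0^{n-|I|}` of a matroid is Lorentzian
# (Brändén–Huh 2020, §4.3: "The polynomial `f_M` is Lorentzian by Theorem 4.10"; Brändén–Huh 2018)

Layer `Literature/Combinatorics/LorentzianPolynomials`, namespace `Literature.Combinatorics.LorentzianPolynomials`;
lane `lit-hodgefound` (Track 2 foundations library), seat p16, generation 27 (row g27-#25). Assembles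
`IndependentSets.lean` (M-convex support of `f_M`), `IndependencePolynomial.lean` (the reduction
`indepGenPoly_mem_lorentzian_iff`), `ParallelOver.lean` (parallel classes of `M/S`) and `LoopMultipartiteSignature.lean`
(the signature of the weighted loop + complete multipartite matrix, via Lemma 4.12).

## Source (verbatim) — P. Brändén, J. Huh, *Lorentzian polynomials* [BrandenHuh2019] (held `paper:arxiv-1902.03719`)

§4.3, proof of Thm. 4.14: "Here we deduce Theorem 4.14 from the Lorentzian property of
`f_M(w_0, w_1, …, w_n) = Σ_{A ∈ 𝓘(M)} w^A w_0^{n-|A|}` […]. The polynomial `f_M` is Lorentzian by Theorem 4.10 and the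
identity `f_M(w_0, w_1, …, w_n) = lim_{q → 0} Z_{q,M}(w_0, q w_1, …, q w_n)`." Proof of Thm. 4.10: "Let `α` be an element of
`Δ^{n-2}_{n+1}`. By Theorem 2.25 and Lemma 4.11, the proof reduces to the statement that the quadratic form
`∂^α Z_{q,M}` is stable. […] `∂_i Z_{q,M} = q^{-rk_M(i)} Z_{q,M/i}` […] Thus, it is enough to prove that the following
quadratic form is stable: `(n!/2) w_0^2 + (n-1)! Z^1_{q,M}(w) w_0 + (n-2)! Z^2_{q,M}(w)`. […] The conclusion now follows
from Lemma 4.12."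

## What is here

* coordinates on the support: `sigmaSupport γ = {k : γ_k ≠ 0}` and `mem_indepExp_iff` (`γ ∈ indepExp M` iff its `σ`-part
  is squarefree with independent support `I` and `γ_0 = n - |I|`), `not_mem_indepExp_of_two_le`, `not_mem_indepExp_of_dep`,
  `sigmaSupport_add_single_some/_none`;
* the entries of the Hessian matrices `N_α = ((α + e_i + e_j)! · coeff_{α+e_i+e_j} f_M)_{i,j}`, `|α| = n - 2`: zero unless
  the `σ`-part of `α` is the indicator of an independent set `S` (`normCoeffMatrix_eq_zero_of_two_le`,
  `normCoeffMatrix_eq_zero_of_dep`), and otherwise `N_α = (m-2)! · H` with `m = n - #S` and `H` the loop + complete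
  multipartite matrix of the non-loops and parallel classes of `M/S` (`normCoeffMatrix_eq_smul_loopMultipartite`);
* **`indepGenPoly_mem_lorentzian`**: `f_M ∈ L^n_{Option σ}` for every matroid `M` on a finite type `σ`, `n = |σ|`.

Two auxiliary definitions with bodies (`sigmaSupport`, `parallelClassMap`), theorems otherwise; no `sorry`, no named fact.

## References

* [BrandenHuh2019] P. Brändén, J. Huh, *Lorentzian polynomials*, Ann. of Math. (2) 192 (2020) 821–891, arXiv:1902.03719 —
  §4.3 (Thm. 4.10 and its proof, Lemma 4.12, proof of Thm. 4.14).
-/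

noncomputable section

open MvPolynomial Finsupp Finset Matrix
open scoped Nat

namespace Literature.Combinatorics.LorentzianPolynomials

variable {σ : Type*} [Fintype σ] [DecidableEq σ]

/-! ## §1 Membership in `indepExp M` by coordinates -/

section Coordinates

omit [Fintype σ] in
/-- The `σ`-part of an exponent `γ ∈ ℕ^{Option σ}` as a set: `{k : γ_k ≠ 0}`. [cite: BrandenHuh2019, §4.3 proof of Thm. 4.14
("`w^A w_0^{n-|A|}`")] -/
def sigmaSupport (γ : Option σ →₀ ℕ) : Set σ := {k | γ (some k) ≠ 0}

omit [Fintype σ] [DecidableEq σ] in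
/-- Unfolding `sigmaSupport`. [cite: BrandenHuh2019, §4.3 proof of Thm. 4.14] -/
theorem mem_sigmaSupport {γ : Option σ →₀ ℕ} {k : σ} : k ∈ sigmaSupport γ ↔ γ (some k) ≠ 0 := Iff.rfl

omit [DecidableEq σ] in
/-- `sigmaSupport (e^♮_I) = I`. [cite: BrandenHuh2019, §4.3 proof of Thm. 4.14] -/
theorem sigmaSupport_homIndSet (I : Set σ) : sigmaSupport (homIndSet I) = I := by
  ext k
  rw [mem_sigmaSupport, homIndSet_some, indSet_ne_zero_iff]

omit [DecidableEq σ] in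
/-- An exponent with squarefree `σ`-part and the right `w_0`-exponent is `e^♮` of its `σ`-part.
[cite: BrandenHuh2019, §4.3 proof of Thm. 4.14] -/
theorem eq_homIndSet_sigmaSupport {γ : Option σ →₀ ℕ} (h01 : ∀ k, γ (some k) ≤ 1)
    (h0 : γ none = Fintype.card σ - (sigmaSupport γ).ncard) : γ = homIndSet (sigmaSupport γ) := by
  classical
  ext o
  cases o with
  | none => rw [homIndSet_none, h0]
  | some k =>
    rw [homIndSet_some, indSet_apply, mem_sigmaSupport]
    have hk := h01 k
    by_cases h : γ (some k) = 0
    · rw [h, if_neg (fun h' ↦ h' rfl)]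
    · rw [if_pos h]; omega

omit [DecidableEq σ] in
/-- **Coordinates of the support of `f_M`**: `γ ∈ indepExp M` iff the `σ`-part of `γ` is squarefree, its support
`I = {k : γ_k ≠ 0}` is independent in `M`, and `γ_0 = n - |I|`. [cite: BrandenHuh2019, §4.3 proof of Thm. 4.14
("`f_M = Σ_{A ∈ 𝓘(M)} w^A w_0^{n-|A|}`")] -/
theorem mem_indepExp_iff {M : Matroid σ} {γ : Option σ →₀ ℕ} :
    γ ∈ indepExp M ↔ (∀ k, γ (some k) ≤ 1) ∧ M.Indep (sigmaSupport γ) ∧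
      γ none = Fintype.card σ - (sigmaSupport γ).ncard := by
  constructor
  · intro h
    obtain ⟨I, hI, rfl⟩ := mem_indepExp.1 h
    rw [sigmaSupport_homIndSet]
    exact ⟨fun k ↦ by rw [homIndSet_some]; exact indSet_le_one I k, hI, homIndSet_none I⟩
  · rintro ⟨h01, hI, h0⟩
    rw [eq_homIndSet_sigmaSupport h01 h0, homIndSet_mem_indepExp]
    exact hI

omit [DecidableEq σ] in
/-- In particular an exponent with some `γ_k ≥ 2` (`k ∈ σ`) is not in the support of `f_M` (`f_M` is multi-affine in
`w_1, …, w_n`). [cite: BrandenHuh2019, §4.3 proof of Thm. 4.14] -/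
theorem not_mem_indepExp_of_two_le {M : Matroid σ} {γ : Option σ →₀ ℕ} {k : σ} (hk : 2 ≤ γ (some k)) :
    γ ∉ indepExp M := fun h ↦ by
  have h1 := (mem_indepExp_iff.1 h).1 k
  omega

omit [DecidableEq σ] in
/-- Nor is an exponent whose `σ`-support is dependent. [cite: BrandenHuh2019, §4.3 proof of Thm. 4.14] -/
theorem not_mem_indepExp_of_dep {M : Matroid σ} {γ : Option σ →₀ ℕ} (h : ¬ M.Indep (sigmaSupport γ)) :
    γ ∉ indepExp M := fun hγ ↦ h (mem_indepExp_iff.1 hγ).2.1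

omit [Fintype σ] in
/-- `sigmaSupport (γ + e_{some k}) = sigmaSupport γ ∪ {k}`. [cite: BrandenHuh2019, §4.3 proof of Thm. 4.14] -/
theorem sigmaSupport_add_single_some (γ : Option σ →₀ ℕ) (k : σ) :
    sigmaSupport (γ + Finsupp.single (some k) 1) = insert k (sigmaSupport γ) := by
  classical
  ext j
  rw [mem_sigmaSupport, Finsupp.add_apply, Finsupp.single_apply, Set.mem_insert_iff, mem_sigmaSupport]
  by_cases h : k = j
  · subst h; simp
  · rw [if_neg (fun h' ↦ h (Option.some_injective _ h')), add_zero]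
    constructor
    · exact Or.inr
    · rintro (rfl | h')
      · exact (h rfl).elim
      · exact h'

omit [Fintype σ] [DecidableEq σ] in
/-- `sigmaSupport (γ + e_0) = sigmaSupport γ`. [cite: BrandenHuh2019, §4.3 proof of Thm. 4.14] -/
theorem sigmaSupport_add_single_none (γ : Option σ →₀ ℕ) :
    sigmaSupport (γ + Finsupp.single none 1) = sigmaSupport γ := by
  ext j
  rw [mem_sigmaSupport, Finsupp.add_apply, Finsupp.single_eq_of_ne (Option.some_ne_none j), add_zero, mem_sigmaSupport]

end Coordinates

/-! ## §2 Coordinates of `α + e_i + e_j` -/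

section Coordinates

omit [DecidableEq σ] in
/-- `|α| = α_0 + Σ_k α_k` on `Option σ`. [cite: BrandenHuh2019, §4.3 proof of Thm. 4.10 ("`α ∈ Δ^{n-2}_{n+1}`")] -/
theorem degree_eq_none_add_sum (α : Option σ →₀ ℕ) : α.degree = α none + ∑ k, α (some k) := by
  rw [Finsupp.degree_eq_sum, Fintype.sum_option]

omit [DecidableEq σ] in
/-- For a squarefree `σ`-part, `Σ_k α_k = #(sigmaSupport α)`. [cite: BrandenHuh2019, §4.3 proof of Thm. 4.10] -/
theorem sum_some_eq_ncard_sigmaSupport {α : Option σ →₀ ℕ} (h01 : ∀ k, α (some k) ≤ 1) :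
    ∑ k, α (some k) = (sigmaSupport α).ncard := by
  classical
  have h : ∀ k, α (some k) = indSet (sigmaSupport α) k := fun k ↦ by
    rw [indSet_apply, mem_sigmaSupport]
    have := h01 k
    by_cases h0 : α (some k) = 0
    · rw [h0, if_neg (fun h ↦ h rfl)]
    · rw [if_pos h0]; omega
  simp_rw [h]
  rw [← Finsupp.degree_eq_sum, degree_indSet]

omit [Fintype σ] in
/-- `(α + e_i + e_j)_o = α_o + [i = o] + [j = o]`. [cite: BrandenHuh2019, §2.2 (p. 11, "`α - e_i + e_j`")] -/
theorem add_single_single_apply (α : Option σ →₀ ℕ) (i j o : Option σ) :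
    (α + Finsupp.single i 1 + Finsupp.single j 1 : Option σ →₀ ℕ) o =
      α o + (if i = o then 1 else 0) + (if j = o then 1 else 0) := by
  rw [Finsupp.add_apply, Finsupp.add_apply, Finsupp.single_apply, Finsupp.single_apply]

end Coordinates

/-! ## §3 The class map of `M/S` -/

section ClassMap

/-- The **parallel-class map** of `M/S`: a non-loop `k` of `M/S` goes to its parallel class, everything else to `none`.
[cite: BrandenHuh2019, §4.3 proof of Thm. 4.10 ("`P_1, …, P_ℓ` […] the parallel classes")] -/
def parallelClassMap (M : Matroid σ) (S : Set σ) (k : σ) : Option (Quotient (parallelOverSetoid M S)) :=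
  open Classical in
  if h : k ∈ nonloopsOver M S then some (Quotient.mk (parallelOverSetoid M S) ⟨k, h⟩) else none

omit [DecidableEq σ] in
/-- Two non-loops have the same class iff they are parallel in `M/S`. [cite: BrandenHuh2019, §4.3 proof of Thm. 4.10] -/
theorem parallelClassMap_eq_iff {M : Matroid σ} {S : Set σ} {k l : σ} (hk : k ∈ nonloopsOver M S)
    (hl : l ∈ nonloopsOver M S) : parallelClassMap M S k = parallelClassMap M S l ↔ ParallelOver M S k l := by
  rw [parallelClassMap, parallelClassMap, dif_pos hk, dif_pos hl, Option.some.injEq, Quotient.eq]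
  exact Iff.rfl

omit [DecidableEq σ] in
/-- For non-loops `k, l` of `M/S`: different classes iff `k ≠ l` and `S + k + l` is independent.
[cite: BrandenHuh2019, §4.3 proof of Thm. 4.10] -/
theorem parallelClassMap_ne_iff {M : Matroid σ} {S : Set σ} {k l : σ} (hk : k ∈ nonloopsOver M S)
    (hl : l ∈ nonloopsOver M S) :
    parallelClassMap M S k ≠ parallelClassMap M S l ↔ k ≠ l ∧ M.Indep (insert k (insert l S)) := by
  rw [Ne, parallelClassMap_eq_iff hk hl]
  constructor
  · intro h
    have hkl : k ≠ l := fun e ↦ h (e ▸ ParallelOver.refl hk)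
    exact ⟨hkl, (not_parallelOver_iff_indep hk hl hkl).1 h⟩
  · rintro ⟨hkl, hi⟩
    exact (not_parallelOver_iff_indep hk hl hkl).2 hi

end ClassMap

/-! ## §4 The Hessian matrices `N_α` of `f_M` -/

section Hessians

/-- If some `σ`-coordinate of `α` is `≥ 2`, all the normalised coefficients `(α + e_i + e_j)! coeff f_M` vanish (`f_M` is
multi-affine in `w_1, …, w_n`). [cite: BrandenHuh2019, §4.3 proof of Thm. 4.10] -/
theorem normCoeff_indepGenPoly_add_eq_zero_of_two_le {M : Matroid σ} {α : Option σ →₀ ℕ} {k : σ} (hk : 2 ≤ α (some k))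
    (i j : Option σ) : normCoeff (α + Finsupp.single i 1 + Finsupp.single j 1) (indepGenPoly M) = 0 := by
  rw [normCoeff_indepGenPoly, if_neg]
  refine not_mem_indepExp_of_two_le (k := k) ?_
  rw [add_single_single_apply]
  omega

/-- If the `σ`-support of `α` is dependent, all the normalised coefficients `(α + e_i + e_j)! coeff f_M` vanish
(supersets of dependent sets are dependent). [cite: BrandenHuh2019, §4.3 proof of Thm. 4.10] -/
theorem normCoeff_indepGenPoly_add_eq_zero_of_dep {M : Matroid σ} {α : Option σ →₀ ℕ}
    (hS : ¬ M.Indep (sigmaSupport α)) (i j : Option σ) :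
    normCoeff (α + Finsupp.single i 1 + Finsupp.single j 1) (indepGenPoly M) = 0 := by
  rw [normCoeff_indepGenPoly, if_neg]
  refine not_mem_indepExp_of_dep fun h ↦ hS (h.subset fun k hk ↦ ?_)
  rw [mem_sigmaSupport] at hk ⊢
  rw [add_single_single_apply]
  omega

/-- **The Hessian matrix `N_α` for `α = (m-2) e_0 + e_S`, `S` independent**: entrywise
`N_α = (m-2)! · H(E', classes, m)` with `E'` the non-loops of `M/S`, `m = n - #S`.
[cite: BrandenHuh2019, §4.3 proof of Thm. 4.10 ("`(n!/2) w_0^2 + (n-1)! Z^1 w_0 + (n-2)! Z^2`" for `M/S`)] -/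
theorem normCoeff_indepGenPoly_add_eq {M : Matroid σ} {α : Option σ →₀ ℕ} {m : ℕ} (h01 : ∀ k, α (some k) ≤ 1)
    (hS : M.Indep (sigmaSupport α)) (hm : Fintype.card σ = m + (sigmaSupport α).ncard) (hα0 : α none + 2 = m)
    [DecidableEq (Option (Quotient (parallelOverSetoid M (sigmaSupport α))))] (i j : Option σ) :
    normCoeff (α + Finsupp.single i 1 + Finsupp.single j 1) (indepGenPoly M) =
      ((m - 2)! : ℝ) * loopMultipartiteMatrix (Set.toFinite (nonloopsOver M (sigmaSupport α))).toFinset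
        (parallelClassMap M (sigmaSupport α)) (m : ℝ) i j := by
  have hm2 : 2 ≤ m := by omega
  have hkE : ∀ k, k ∈ (Set.toFinite (nonloopsOver M (sigmaSupport α))).toFinset ↔ k ∈ nonloopsOver M (sigmaSupport α) :=
    fun k ↦ Set.Finite.mem_toFinset _
  rw [normCoeff_indepGenPoly]
  -- membership of `γ = α + e_i + e_j` in `indepExp M`, by cases on `i, j`
  cases i with
  | none => cases j with
    | none =>
      -- `γ = α + 2 e_0 ∈ indepExp`, value `m!`
      have hmem : α + Finsupp.single none 1 + Finsupp.single none 1 ∈ indepExp M := by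
        rw [mem_indepExp_iff, sigmaSupport_add_single_none, sigmaSupport_add_single_none]
        refine ⟨fun k ↦ ?_, hS, ?_⟩
        · rw [add_single_single_apply, if_neg (Option.some_ne_none k).symm]; simpa using h01 k
        · rw [add_single_single_apply, if_pos rfl]; omega
      rw [if_pos hmem, loopMultipartite_none_none, add_single_single_apply, if_pos rfl]
      have : α none + 1 + 1 = m := by omega
      rw [this]
      obtain ⟨r, rfl⟩ : ∃ r, m = r + 2 := ⟨m - 2, by omega⟩
      rw [Nat.add_sub_cancel, Nat.factorial_succ, Nat.factorial_succ]
      push_cast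
      ring
    | some l =>
      rw [loopMultipartite_none_some]
      by_cases hl : l ∈ nonloopsOver M (sigmaSupport α)
      · have hmem : α + Finsupp.single none 1 + Finsupp.single (some l) 1 ∈ indepExp M := by
          rw [mem_indepExp_iff, sigmaSupport_add_single_some, sigmaSupport_add_single_none]
          have hlS : l ∉ (sigmaSupport α) := hl.1
          refine ⟨fun k ↦ ?_, hl.2, ?_⟩
          · rw [add_single_single_apply, if_neg (Option.some_ne_none k).symm]
            by_cases hkl : l = k
            · subst hkl
              have : α (some l) = 0 := by rw [mem_sigmaSupport, not_not] at hlS; exact hlS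
              rw [this, if_pos rfl]
            · rw [if_neg (fun h ↦ hkl (Option.some_injective _ h))]; simpa using h01 k
          · rw [add_single_single_apply, if_pos rfl, if_neg (Option.some_ne_none l),
              Set.ncard_insert_of_notMem hlS (Set.toFinite (sigmaSupport α))]
            omega
        rw [if_pos hmem, if_pos ((hkE l).2 hl), add_single_single_apply, if_pos rfl, if_neg (Option.some_ne_none l)]
        have : α none + 1 + 0 = (m - 2) + 1 := by omega
        rw [this, Nat.factorial_succ]
        have hc : ((m - 2 : ℕ) : ℝ) = (m : ℝ) - 2 := by rw [Nat.cast_sub hm2]; norm_num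
        push_cast
        rw [hc]
        ring
      · rw [if_neg, if_neg (fun h ↦ hl ((hkE l).1 h)), mul_zero]
        rw [mem_indepExp_iff, sigmaSupport_add_single_some, sigmaSupport_add_single_none]
        rintro ⟨h1, h2, -⟩
        apply hl
        refine ⟨fun hlS ↦ ?_, h2⟩
        have := h1 l
        rw [add_single_single_apply, if_neg (Option.some_ne_none l).symm, if_pos rfl] at this
        rw [mem_sigmaSupport] at hlS
        omega
  | some k => cases j with
    | none =>
      rw [loopMultipartite_some_none]
      by_cases hk : k ∈ nonloopsOver M (sigmaSupport α)
      · have hmem : α + Finsupp.single (some k) 1 + Finsupp.single none 1 ∈ indepExp M := by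
          rw [mem_indepExp_iff, sigmaSupport_add_single_none, sigmaSupport_add_single_some]
          have hkS : k ∉ (sigmaSupport α) := hk.1
          refine ⟨fun k' ↦ ?_, hk.2, ?_⟩
          · rw [add_single_single_apply, if_neg (Option.some_ne_none k').symm, add_zero]
            by_cases hkk : k = k'
            · subst hkk
              have : α (some k) = 0 := by rw [mem_sigmaSupport, not_not] at hkS; exact hkS
              rw [this, if_pos rfl]
            · rw [if_neg (fun h ↦ hkk (Option.some_injective _ h))]; simpa using h01 k'
          · rw [add_single_single_apply, if_neg (Option.some_ne_none k), if_pos rfl,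
              Set.ncard_insert_of_notMem hkS (Set.toFinite (sigmaSupport α))]
            omega
        rw [if_pos hmem, if_pos ((hkE k).2 hk), add_single_single_apply, if_neg (Option.some_ne_none k), if_pos rfl]
        have : α none + 0 + 1 = (m - 2) + 1 := by omega
        rw [this, Nat.factorial_succ]
        have hc : ((m - 2 : ℕ) : ℝ) = (m : ℝ) - 2 := by rw [Nat.cast_sub hm2]; norm_num
        push_cast
        rw [hc]
        ring
      · rw [if_neg, if_neg (fun h ↦ hk ((hkE k).1 h)), mul_zero]
        rw [mem_indepExp_iff, sigmaSupport_add_single_none, sigmaSupport_add_single_some]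
        rintro ⟨h1, h2, -⟩
        apply hk
        refine ⟨fun hkS ↦ ?_, h2⟩
        have := h1 k
        rw [add_single_single_apply, if_pos rfl, if_neg (Option.some_ne_none k).symm] at this
        rw [mem_sigmaSupport] at hkS
        omega
    | some l =>
      rw [loopMultipartite_some_some]
      by_cases hgood : k ∈ nonloopsOver M (sigmaSupport α) ∧ l ∈ nonloopsOver M (sigmaSupport α) ∧
          parallelClassMap M (sigmaSupport α) k ≠ parallelClassMap M (sigmaSupport α) l
      · obtain ⟨hk, hl, hne⟩ := hgood
        obtain ⟨hkl, hind⟩ := (parallelClassMap_ne_iff hk hl).1 hne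
        have hkS : k ∉ (sigmaSupport α) := hk.1
        have hlS : l ∉ (sigmaSupport α) := hl.1
        have hmem : α + Finsupp.single (some k) 1 + Finsupp.single (some l) 1 ∈ indepExp M := by
          rw [mem_indepExp_iff, sigmaSupport_add_single_some, sigmaSupport_add_single_some]
          refine ⟨fun k' ↦ ?_, by rwa [Set.insert_comm], ?_⟩
          · rw [add_single_single_apply]
            have hαk : α (some k) = 0 := by rw [mem_sigmaSupport, not_not] at hkS; exact hkS
            have hαl : α (some l) = 0 := by rw [mem_sigmaSupport, not_not] at hlS; exact hlS
            by_cases h1 : k = k'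
            · subst h1
              rw [hαk, if_pos rfl, if_neg (fun h ↦ hkl (Option.some_injective _ h).symm)]
            · rw [if_neg (fun h ↦ h1 (Option.some_injective _ h))]
              by_cases h2 : l = k'
              · subst h2; rw [hαl, if_pos rfl]
              · rw [if_neg (fun h ↦ h2 (Option.some_injective _ h))]; simpa using h01 k'
          · rw [add_single_single_apply, if_neg (Option.some_ne_none k), if_neg (Option.some_ne_none l),
              Set.ncard_insert_of_notMem (fun h ↦ hlS ((Set.mem_insert_iff.1 h).resolve_left hkl.symm))
                (Set.toFinite _), Set.ncard_insert_of_notMem hkS (Set.toFinite (sigmaSupport α))]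
            omega
        rw [if_pos hmem, if_pos ⟨(hkE k).2 hk, (hkE l).2 hl, hne⟩, add_single_single_apply, if_neg (Option.some_ne_none k),
          if_neg (Option.some_ne_none l), add_zero, add_zero, mul_one]
        have : α none = m - 2 := by omega
        rw [this]
      · have hnot : α + Finsupp.single (some k) 1 + Finsupp.single (some l) 1 ∉ indepExp M := by
          intro hmem
          apply hgood
          rw [mem_indepExp_iff, sigmaSupport_add_single_some, sigmaSupport_add_single_some] at hmem
          obtain ⟨h1, h2, -⟩ := hmem
          have hkl : k ≠ l := fun e ↦ by
            subst e
            have := h1 k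
            rw [add_single_single_apply, if_pos rfl] at this
            omega
          have hkS : k ∉ sigmaSupport α := fun hkS ↦ by
            have := h1 k
            rw [add_single_single_apply, if_pos rfl, if_neg (fun h ↦ hkl (Option.some_injective _ h).symm)] at this
            rw [mem_sigmaSupport] at hkS
            omega
          have hlS : l ∉ sigmaSupport α := fun hlS ↦ by
            have := h1 l
            rw [add_single_single_apply, if_neg (fun h ↦ hkl (Option.some_injective _ h)), if_pos rfl] at this
            rw [mem_sigmaSupport] at hlS
            omega
          have hk : k ∈ nonloopsOver M (sigmaSupport α) := ⟨hkS, h2.subset (Set.subset_insert _ _)⟩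
          have hl : l ∈ nonloopsOver M (sigmaSupport α) :=
            ⟨hlS, h2.subset (Set.insert_subset_insert (Set.subset_insert _ _))⟩
          refine ⟨hk, hl, (parallelClassMap_ne_iff hk hl).2 ⟨hkl, ?_⟩⟩
          rwa [Set.insert_comm] at h2
        rw [if_neg hnot, if_neg (fun h ↦ hgood ⟨(hkE k).1 h.1, (hkE l).1 h.2.1, h.2.2⟩), mul_zero]

end Hessians

/-! ## §5 `f_M` is Lorentzian -/

section Main

/-- `sigPos` is unchanged by a positive scalar. [cite: BrandenHuh2019, §2.2 Def. 2.6 (the eigenvalue condition is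
invariant under positive scaling)] -/
theorem sigPos_smul_eq_of_pos {V : Type*} [AddCommGroup V] [Module ℝ V] [FiniteDimensional ℝ V]
    (Q : QuadraticForm ℝ V) {c : ℝ} (hc : 0 < c) : sigPos (c • Q) = sigPos Q := by
  apply le_antisymm
  · obtain ⟨W, hW, hpos⟩ := exists_finrank_eq_sigPos_and_posDef (c • Q)
    rw [← hW]
    refine le_sigPos_of_posDef Q fun x hx ↦ ?_
    have h := hpos x hx
    simp only [QuadraticMap.restrict_apply, QuadraticMap.smul_apply, smul_eq_mul] at h ⊢
    exact pos_of_mul_pos_right h hc.le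
  · obtain ⟨W, hW, hpos⟩ := exists_finrank_eq_sigPos_and_posDef Q
    rw [← hW]
    refine le_sigPos_of_posDef (c • Q) fun x hx ↦ ?_
    have h := hpos x hx
    simp only [QuadraticMap.restrict_apply, QuadraticMap.smul_apply, smul_eq_mul] at h ⊢
    exact mul_pos hc h

/-- The zero matrix has `sigPos = 0 ≤ 1`. [cite: BrandenHuh2019, §2.2 Def. 2.6] -/
theorem sigPos_toBilin'_le_one_of_eq_zero {ι : Type*} [Fintype ι] [DecidableEq ι] {N : Matrix ι ι ℝ} (hN : N = 0) :
    sigPos (Matrix.toBilin' N).toQuadraticMap ≤ 1 := by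
  subst hN
  refine Literature.LinearAlgebra.QuadraticForm.sigPos_le_one_of_orthogonal_nonpos (Matrix.toBilin' (0 : Matrix ι ι ℝ))
    (w := 0) fun z _ ↦ ?_
  simp

/-- **Brändén–Huh: the homogenised independence polynomial `f_M = Σ_{I ∈ 𝓘(M)} w^I w_0^{n-|I|}` of a matroid `M` on a
finite set of size `n` is Lorentzian** ("The polynomial `f_M` is Lorentzian by Theorem 4.10"; here by the `q → 0` form
of the printed proof of Thm. 4.10: M-convex support, and for each `α ∈ Δ^{n-2}` the Hessian of `∂^α f_M` is `(m-2)!`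
times the weighted loop + complete multipartite matrix of the non-loops and parallel classes of `M/S`, which has at most
one positive eigenvalue by Lemma 4.12). [cite: BrandenHuh2019, §4.3 proof of Thm. 4.14 with Thm. 4.10, Lemma 4.12] -/
theorem indepGenPoly_mem_lorentzian (M : Matroid σ) : indepGenPoly M ∈ lorentzian (Option σ) (Fintype.card σ) := by
  classical
  rcases Nat.lt_or_ge (Fintype.card σ) 2 with hlt | hge
  · exact indepGenPoly_mem_lorentzian_of_card_le_one M (by omega)
  obtain ⟨m', hm'⟩ : ∃ m', Fintype.card σ = m' + 2 := ⟨Fintype.card σ - 2, by omega⟩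
  rw [indepGenPoly_mem_lorentzian_iff M hm']
  intro α hα
  -- Case A: some `σ`-coordinate of `α` is `≥ 2`
  by_cases h01 : ∀ k, α (some k) ≤ 1
  swap
  · push Not at h01
    obtain ⟨k, hk⟩ := h01
    exact sigPos_toBilin'_le_one_of_eq_zero (Matrix.ext fun i j ↦ by
      rw [Matrix.of_apply, Matrix.zero_apply]
      exact normCoeff_indepGenPoly_add_eq_zero_of_two_le (k := k) (by omega) i j)
  -- Case B1: the `σ`-support `S` of `α` is dependent
  by_cases hS : M.Indep (sigmaSupport α)
  swap
  · exact sigPos_toBilin'_le_one_of_eq_zero (Matrix.ext fun i j ↦ by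
      rw [Matrix.of_apply, Matrix.zero_apply]; exact normCoeff_indepGenPoly_add_eq_zero_of_dep hS i j)
  -- Case B2: `α = (m-2) e_0 + e_S` with `S` independent, `m = n - #S ≥ 2`
  set S := sigmaSupport α with hSdef
  have hdeg : α none + S.ncard = m' := by
    rw [← hα, degree_eq_none_add_sum, sum_some_eq_ncard_sigmaSupport h01]
  have hSn : S.ncard ≤ Fintype.card σ := ncard_le_card S
  set m : ℕ := Fintype.card σ - S.ncard with hmdef
  have hm : Fintype.card σ = m + S.ncard := by omega
  have hα0 : α none + 2 = m := by omega
  have hN : (Matrix.of fun i j ↦ normCoeff (α + Finsupp.single i 1 + Finsupp.single j 1) (indepGenPoly M)) =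
      ((m - 2)! : ℝ) • loopMultipartiteMatrix (Set.toFinite (nonloopsOver M S)).toFinset (parallelClassMap M S) (m : ℝ) := by
    ext i j
    rw [Matrix.of_apply, Matrix.smul_apply, smul_eq_mul]
    exact normCoeff_indepGenPoly_add_eq h01 hS hm hα0 i j
  rw [hN, map_smul, LinearMap.BilinMap.toQuadraticMap_smul,
    sigPos_smul_eq_of_pos _ (by exact_mod_cast Nat.factorial_pos (m - 2))]
  refine sigPos_loopMultipartite_le_one _ _ ?_ (by exact_mod_cast (show 1 < m by omega))
  rw [← Set.ncard_eq_toFinset_card _ (Set.toFinite (nonloopsOver M S))]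
  exact_mod_cast (ncard_nonloopsOver_le M S).trans (by omega)

end Main

end Literature.Combinatorics.LorentzianPolynomials

end
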